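import Literature.Computability.Complexity.IWReconstructionWeakStage
import Literature.Computability.Complexity.StringCopy
import Literature.Computability.MetaComplexity.NWTableGenerator
import Literature.Computability.Complexity.IWBootstrappingEventually
import Literature.Computability.Complexity.BFNWCase1
import Literature.Computability.Complexity.UniformDerandomizationEndgame
import Literature.Computability.Complexity.ExpClosure
import Literature.Computability.Complexity.TVHardness
import Literature.Computability.Complexity.TVLanguageEXP
import HarnessLib

/-!
# IW98 Case 2 (`EXP ⊆ P/poly`, `EXP ≠ BPP`): the generator of the reconstruction, fed with a truth
# table, and `impagliazzoWigderson1998_samplable` from a PSPACE-complete, downward-self-reducible,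
# self-correctible function

Literature / complexity — derandomization under a uniform assumption (Impagliazzo–Wigderson 1998,
Thm. 5 = van Melkebeek Thm. 6.2.1); sequel of `IWReconstructionWeakStage.lean`. Three parts, each with
its own section docstring below: (1) the GENERATOR `IWGen2.gStr` (NW with CIKK's design on `AMP_k(f_m)`,
`m = ⌊N^{2^{−j}}⌋`) and `IWGen2.reducibleUsing_of_not_IOFools` (if it does not io-fool the weakly
constructible one-sided tests, `C^{f,1−2/D}` is constructible using `f_m`); (2) the generator as a
TABLE GENERATOR in `FP` (`IWGen2.genTT`, `tableGen_genTT_eq`), so that the assembly's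
`IWUniform.exists_tableGen_machine` / `matrix_clause_tableGen` apply; (3) the ASSEMBLY:
`IWGen2.uniformPRGAt_of_hardFunction` (Case 2's `IWUniform.UniformPRGAt ε q`) and
**`impagliazzoWigderson1998_samplable_of_hardFunction`** — the fact from an explicit package of facts
about the hard function `f₀` (PSPACE-hard, in `EXP`, downward self-reducible by a polynomial-time oracle
machine, random self-reducible by polynomial-time post-processing of approximating descriptions:
Trevisan–Vadhan Thm. 4.3 in machine form), Case 1 being the tree's
`IWUniform.ioPRGAt_of_not_EXP_subset_PPoly`.

Everything is proved; the F-side facts are hypotheses of the theorems (no named facts).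

## References

* [ImpagliazzoWigderson2001] R. Impagliazzo, A. Wigderson, JCSS 63 (2001) 672–688, Thm. 5, §2
  (Lemmas 11–17, Defs. 2–5; held text pp. 4–9).
* [TrevisanVadhan2007] L. Trevisan, S. Vadhan, Comput. Complexity 16 (2007), §3 and Thm. 4.3.
* [VanMelkebeek2000] D. van Melkebeek, LNCS 1950, Thm. 6.2.1 (p. 142).
* [CarmosinoImpagliazzoKabanetsKolokolova2016] CCC 2016, Thm. 5.1.
* [ImpagliazzoKabanetsWigderson2002] JCSS 65 (2002), Thm. 11; [AroraBarakCC2009] CUP 2009, §20.2.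
-/

/-! ## Part: the generator and its distinguishers

# IW98 Case 2: the generator of the reconstruction and its distinguishers as a sampled stage

Literature / complexity — derandomization under a uniform assumption; sequel of
`IWReconstructionDistinguishers.lean` and `IWReconstructionStageSampled.lean`. The generator family
that the assembly of the printed proof (`UniformDerandomizationAssembly.lean`: `IWUniform.UniformPRGAt`,
`IWUniform.IOFools`) asks for in Case 2, indexed by the input length `N` of the `BPP` algorithm, with
hard-function length `m = ⌊N^{2^{−j}}⌋` (`Nat.sqrt^[j] N`): the NW generator with CIKK's design on the
amplification `AMP_{k(m)}(f_m)` of the hard function, listed as a string and truncated to the `q(N)`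
coins of the algorithm. If it does NOT io-fool the weakly constructible one-sided tests
(`¬ IOFools`), the sampler of good test indices — re-indexed (`IWDist.reIdx`) and run on a fixed
coin budget (`UDerand.xF'`) at the representative length `N = m^{2^j}` — is exactly the `FP` sampler
the sampled reconstruction stage consumes, whence `C^{f,1−2/D(m)}` is constructible using `f_m` as an
oracle from some `m` on:

* `IWGen2.hardLen j N = Nat.sqrt^[j] N`, `IWGen2.Nrep j m = m^{2^j}` (`hardLen_Nrep`,
  `lt_succ_pow_of_hardLen_eq`); `IWGen2.Lx q j m` — the output-length exponent at hard length `m`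
  (`eval_le_two_pow_Lx`: `q(N) ≤ 2^{Lx}` whenever `hardLen j N = m`);
* `IWGen2.Gfun f pD q j m` — the functional generator at hard length `m`; **`IWGen2.gStr`** — the
  string generator at `BPP` length `N` (`kSeed` seed bits, `q(N)` output bits);
* `IWGen2.truncInd` — the `FP` indicator of `IWDist.truncLang L''` for `L'' ∈ P`;
* **`IWGen2.sampler_of_not_IOFools`** — `¬ IOFools gStr kSeed q` yields `L'' ∈ P` and an `FP`
  sampler hitting `IWStage.distIdx (truncLang L'') f … (1/4)` with probability `≥ 1/pS(m)` from some
  `m` on (`iOFools_iff`, `RandAlg.pr_eq_uniformProb`, `IWDist.inv_le_pr_xF'`,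
  `IWDist.le_advantage_of_mem_goodIdx`);
* **`IWGen2.reducibleUsing_of_not_IOFools`** — hence (with `IWStage.reducibleUsing_sampled`) some
  `L'' ∈ P` and `n₀` with `ReducibleUsing (fun m => {z | n₀ ≤ m}) (approxCircuits (evalFnIdx dL) f (2/pD)) f id`
  for the `FP` indicator `dL` of `truncLang L''`: IW98's Lemmas 13′–15 for this generator.

Everything is proved; no named facts.

## References

* [ImpagliazzoWigderson2001] R. Impagliazzo, A. Wigderson, JCSS 63 (2001) 672–688, §2.1–2.4
  (Lemmas 13–15, 17; held text pp. 5–8).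
* [CarmosinoImpagliazzoKabanetsKolokolova2016] CCC 2016, Thm. 5.1.
-/
noncomputable section

namespace Literature.Computability.Complexity

namespace IWGen2

open _root_.Computability Polynomial Real Filter Brick Plumb HashBricks UDerand IWUniform IWDist
  Literature.Computability.Learning Literature.Computability.MetaComplexity Literature.Computability.MetaComplexity.MCSPVerif

/-! ### Lengths -/

/-- The hard-function length at `BPP` length `N`: `⌊N^{2^{−j}}⌋` as `j` integer square roots
(the tree's `NKannan` convention). [cite: ImpagliazzoWigderson2001, §2.1] -/
def hardLen (j N : ℕ) : ℕ := Nat.sqrt^[j] N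

/-- The representative `BPP` length of hard length `m`: `m^{2^j}`. [folklore] -/
def Nrep (j m : ℕ) : ℕ := m ^ 2 ^ j

/-- `hardLen j (m^{2^j}) = m`. [folklore] -/
theorem hardLen_Nrep (j m : ℕ) : hardLen j (Nrep j m) = m := by
  induction j with
  | zero => simp [hardLen, Nrep]
  | succ j ih =>
    rw [hardLen, Function.iterate_succ_apply, Nrep, pow_succ, pow_mul, pow_two, Nat.sqrt_eq]
    exact ih

/-- If `hardLen j N = m` then `N < (m+1)^{2^j}`. [folklore] -/
theorem lt_succ_pow_of_hardLen_eq : ∀ (j : ℕ) {N m : ℕ}, hardLen j N = m → N < (m + 1) ^ 2 ^ j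
  | 0, N, m, h => by simp [hardLen] at h; simp [h]
  | j + 1, N, m, h => by
    rw [hardLen, Function.iterate_succ_apply] at h
    have ih := lt_succ_pow_of_hardLen_eq j (N := Nat.sqrt N) h
    have h1 : N < (Nat.sqrt N + 1) * (Nat.sqrt N + 1) := Nat.lt_succ_sqrt N
    have h2 : Nat.sqrt N + 1 ≤ (m + 1) ^ 2 ^ j := ih
    calc N < (Nat.sqrt N + 1) * (Nat.sqrt N + 1) := h1
      _ ≤ (m + 1) ^ 2 ^ j * (m + 1) ^ 2 ^ j := Nat.mul_le_mul h2 h2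
      _ = (m + 1) ^ 2 ^ (j + 1) := by rw [pow_succ, pow_mul, pow_two]

variable (q : Polynomial ℕ) (j : ℕ)

/-- **The output-length exponent at hard length `m`**: `Lx = |bin q((m+1)^{2^j})|`, so that
`q(N) ≤ 2^{Lx}` for every `N` of hard length `m`. [folklore] -/
def Lx (m : ℕ) : ℕ := Nat.size (q.eval ((m + 1) ^ 2 ^ j))

/-- `q(N) ≤ 2^{Lx m}` when `hardLen j N = m`. [folklore] -/
theorem eval_le_two_pow_Lx {N m : ℕ} (h : hardLen j N = m) : q.eval N ≤ 2 ^ Lx q j m := by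
  have hN := (lt_succ_pow_of_hardLen_eq j h).le
  exact ((TM2Iter.eval_mono q hN).trans (Nat.lt_size_self _).le)

/-- A polynomial cap: `2^{Lx m} ≤ pL(m)` with `pL = (2q + 1) ∘ (X+1)^{2^j}`. [folklore] -/
def pL : Polynomial ℕ := (2 * q + 1).comp ((X + 1) ^ 2 ^ j)

/-- `2^{Lx m} ≤ pL(m)`. [folklore] -/
theorem two_pow_Lx_le (m : ℕ) : 2 ^ Lx q j m ≤ (pL q j).eval m := by
  rw [Lx, pL, eval_comp]
  simp only [eval_add, eval_mul, eval_pow, eval_X, eval_ofNat, eval_one]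
  exact IWStage.Params.two_pow_size_le _

/-- `Lx` in unary, as an `FP` map of `1ᵐ`. [folklore] -/
def LxF : List Bool → List Bool := onesFn ∘ lenBinF ∘ polyFn (q.comp ((X + 1) ^ 2 ^ j))

/-- `LxF ∈ FP`. [folklore] -/
theorem LxF_mem_FP : LxF q j ∈ FP := comp_mem_FP onesFn_mem_FP (comp_mem_FP lenBinF_mem_FP (polyFn_mem_FP _))

/-- Value of `LxF`. [folklore] -/
theorem LxF_apply (m : ℕ) : LxF q j (ones m) = ones (Lx q j m) := by
  rw [LxF, Function.comp_apply, Function.comp_apply, polyFn_apply, lenBinF_apply, onesFn_eq_ones, TM2Pass.length_encodeNat_eq_size,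
    IWStage.Params.length_ones', Lx, eval_comp]
  simp only [eval_add, eval_pow, eval_X, eval_one, IWStage.Params.length_ones']

/-! ### The generator -/

variable (f : List Bool → Bool) (pD : Polynomial ℕ)

/-- The amplification parameter at hard length `m`. [folklore] -/
def kc (m : ℕ) : ℕ := IWStage.Params.kOf (fun n => pD.eval n) m

/-- The field size at hard length `m` (a prime `≥ k m + k`). [folklore] -/
def fld (m : ℕ) : ℕ := IWStage.qOf m (kc pD m)

/-- The field size is prime (instance). [folklore] -/
instance fld_prime (m : ℕ) : Fact (fld pD m).Prime := IWStage.qOf_prime _ _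

/-- **The functional generator at hard length `m`**: NW with CIKK's design on `AMP_k(f_m)`, `2^{Lx}`
output bits, seeds on the universe `Fin (fld²)`. [cite: ImpagliazzoWigderson2001, §2.3–2.4]
[cite: CarmosinoImpagliazzoKabanetsKolokolova2016, §5] -/
def Gfun (m : ℕ) : (Fin (fld pD m * fld pD m) → Bool) → (Fin (2 ^ Lx q j m) → Bool) :=
  nwGenerator (learnerDesign (fld pD m) m (kc pD m) (Lx q j m) (IWStage.knk_le_qOf m (kc pD m)))
    (ampFnFin (fun v : Fin m → Bool => f (List.ofFn v)) (kc pD m))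

/-- **The string generator at `BPP` length `N`**: the output of `Gfun` at hard length `hardLen j N`,
truncated to `q(N)` bits. [cite: ImpagliazzoWigderson2001, §2.1] -/
def gStr (N : ℕ) (s : List Bool) : List Bool := (genList (Gfun q j f pD (hardLen j N)) s).take (q.eval N)

/-- The seed length at `BPP` length `N`. [folklore] -/
def kSeed (N : ℕ) : ℕ := fld pD (hardLen j N) * fld pD (hardLen j N)

/-! ### The indicator of the truncation language -/

/-- The truncation map `⟨⟨x, u⟩, y⟩ ↦ ⟨x, y ↾ |u|⟩`. [folklore] -/
def truncFn : List Bool → List Bool := fanoutFn (fstF ∘ fstF) (takeFn ∘ fanoutFn (sndF ∘ fstF) sndF)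

/-- `truncFn ∈ FP`. [folklore] -/
theorem truncFn_mem_FP : truncFn ∈ FP :=
  fanoutFn_mem_FP (comp_mem_FP fstF_mem_FP fstF_mem_FP) (comp_mem_FP takeFn_mem_FP (fanoutFn_mem_FP (comp_mem_FP sndF_mem_FP fstF_mem_FP) sndF_mem_FP))

/-- Value of `truncFn`. [folklore] -/
theorem truncFn_eq (u : List Bool) : truncFn u = boolPair (fstF (fstF u)) ((sndF u).take (sndF (fstF u)).length) := by
  simp only [truncFn, fanoutFn_apply, Function.comp_apply, takeFn_boolPair]

/-- `u ∈ truncLang L'' ↔ truncFn u ∈ L''`. [folklore] -/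
theorem mem_truncLang_iff_truncFn (L'' : Language Bool) (u : List Bool) : u ∈ truncLang L'' ↔ truncFn u ∈ L'' := by
  rw [truncFn_eq]; exact Iff.rfl

/-- **The `FP` indicator of the truncation language** for `L'' ∈ P`. [folklore] -/
def truncInd (L'' : Language Bool) : List Bool → List Bool := (fun x => encodeBool (L''.boolIndicator x)) ∘ truncFn

/-- `truncInd L'' ∈ FP` for `L'' ∈ P`. [folklore] -/
theorem truncInd_mem_FP {L'' : Language Bool} (hL : L'' ∈ Classes.P) : truncInd L'' ∈ FP :=
  comp_mem_FP (indicatorFn_mem_FP hL) truncFn_mem_FP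

/-- `truncInd` is the indicator of `truncLang`. [folklore] -/
theorem truncInd_apply (L'' : Language Bool) (u : List Bool) : truncInd L'' u = encodeBool ((truncLang L'').boolIndicator u) := by
  rw [truncInd, Function.comp_apply]
  refine congrArg encodeBool ?_
  by_cases h : truncFn u ∈ L''
  · rw [(Set.mem_iff_boolIndicator _ _).1 h, (Set.mem_iff_boolIndicator _ _).1 ((mem_truncLang_iff_truncFn L'' u).2 h)]
  · rw [(Set.notMem_iff_boolIndicator _ _).1 h,
      (Set.notMem_iff_boolIndicator _ _).1 fun hh => h ((mem_truncLang_iff_truncFn L'' u).1 hh)]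

/-! ### The sampler of distinguisher indices from `¬ IOFools` -/

/-- The sampler of the reconstruction: re-index the fixed-budget run of `S` at the representative
length `N = m^{2^j}`, output length `q(N)`: `⟨1ᵐ, r⟩ ↦ reIdx (q N) (xF' S p ⟨1^N, r⟩)`. [folklore] -/
def smpF (S : RandAlg ℕ (List Bool)) (p : Polynomial ℕ) : List Bool → List Bool :=
  reIdxFn ∘ fanoutFn (polyFn (q.comp (X ^ 2 ^ j)) ∘ fstF)
    (xF' S p ∘ fanoutFn (polyFn (X ^ 2 ^ j) ∘ fstF) sndF)

/-- `smpF ∈ FP` for a PPT `S`. [folklore] -/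
theorem smpF_mem_FP {S : RandAlg ℕ (List Bool)} (hS : S.IsPolyTime unaryEncodeNat id) (p : Polynomial ℕ) : smpF q j S p ∈ FP := by
  have hx : xF' S p ∈ FP := by
    have hP : PUF p ∈ FP := comp_mem_FP (polyFn_mem_FP p) fstF_mem_FP
    have hL : LUF p ∈ FP := comp_mem_FP (cons_mem_FP true) (comp_mem_FP onesFn_mem_FP (comp_mem_FP lenBinF_mem_FP hP))
    have hj : jUF p ∈ FP :=
      comp_mem_FP binToUnaryFn_mem_FP (fanoutFn_mem_FP hP (comp_mem_FP takeFn_mem_FP (fanoutFn_mem_FP hL sndF_mem_FP)))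
    have hu : uF' p ∈ FP :=
      comp_mem_FP takeFn_mem_FP (fanoutFn_mem_FP hj (comp_mem_FP dropFn_mem_FP (fanoutFn_mem_FP hL sndF_mem_FP)))
    exact comp_mem_FP (sampleFn_mem_FP hS) (fanoutFn_mem_FP fstF_mem_FP hu)
  exact comp_mem_FP reIdxFn_mem_FP (fanoutFn_mem_FP (comp_mem_FP (polyFn_mem_FP _) fstF_mem_FP)
    (comp_mem_FP hx (fanoutFn_mem_FP (comp_mem_FP (polyFn_mem_FP _) fstF_mem_FP) sndF_mem_FP)))

/-- Value of `smpF`. [folklore] -/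
theorem smpF_apply (S : RandAlg ℕ (List Bool)) (p : Polynomial ℕ) (m : ℕ) (r : List Bool) :
    smpF q j S p (boolPair (ones m) r) = reIdx (q.eval (Nrep j m)) (xF' S p (boolPair (unaryEncodeNat (Nrep j m)) r)) := by
  rw [smpF, Function.comp_apply, fanoutFn_apply, Function.comp_apply, fstF_boolPair, polyFn_apply, Function.comp_apply,
    fanoutFn_apply, Function.comp_apply, fstF_boolPair, polyFn_apply, sndF_boolPair, IWStage.Params.length_ones', eval_comp,
    eval_pow, eval_X, reIdxFn_apply, OracleCompose.unaryEncodeNat_eq_replicate, Nrep]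

/-- **The sampler from `¬ IOFools`.** If the string generator does not io-fool the weakly
constructible one-sided tests on `q(N)` coins, then for some `L'' ∈ P`, some PPT budget `p` and
sampler `S`, and some exponent `c`, from some hard length `m` on the `FP` sampler `smpF` hits the
distinguisher indices of the reconstruction (advantage `≥ 1/4` of the re-indexed test of the
truncation language against `Gfun … m`) with probability `≥ 1/(4(p(N)+1)(N+1)^c)`, `N = m^{2^j}`.
[cite: ImpagliazzoWigderson2001, Lemmas 13, 17 (negated hypotheses) and Def. 3] -/
theorem sampler_of_not_IOFools (hnot : ¬ IOFools (gStr q j f pD) (kSeed j pD) fun N => q.eval N) :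
    ∃ L'' ∈ Classes.P, ∃ (S : RandAlg ℕ (List Bool)) (p : Polynomial ℕ) (c n₁ : ℕ),
      S.IsPolyTime unaryEncodeNat (id : List Bool → List Bool) ∧
      ∀ m, n₁ ≤ m → ∀ n₀, n₀ ≤ m →
        1 / ((4 * (p.eval (Nrep j m) + 1) * (Nrep j m + 1) ^ c : ℕ) : ℝ) ≤
          uniformProb ((2 * p + 1).eval (Nrep j m)) {r | smpF q j S p (boolPair (ones m) r) ∈
            IWStage.distIdx (truncLang L'') f (kc pD) (Lx q j) (fun _ => 1 / 4) n₀ m} := by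
  rw [iOFools_iff] at hnot
  push Not at hnot
  obtain ⟨L'', hL, hW⟩ := hnot
  obtain ⟨S, hS, c, hc⟩ := hW
  obtain ⟨p, hp⟩ := hS.2
  -- from some `N₀` on the sampler hits the good indices; pull back to hard lengths `m ≥ n₁`
  obtain ⟨N₀, hev⟩ := Filter.eventually_atTop.1 hc
  refine ⟨L'', hL, S, p, c, max N₀ 1, hS, fun m hm n₀ hn₀ => ?_⟩
  have hm1 : 1 ≤ m := le_trans (le_max_right _ _) hm
  have hNm : m ≤ Nrep j m := by
    rw [Nrep]
    calc m = m ^ 1 := (pow_one m).symm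
      _ ≤ m ^ 2 ^ j := Nat.pow_le_pow_right hm1 Nat.one_le_two_pow
  have hN₀ : N₀ ≤ Nrep j m := le_trans (le_trans (le_max_left _ _) hm) hNm
  have hNpos : 0 < Nrep j m := lt_of_lt_of_le hm1 hNm
  have hgood := hev (Nrep j m) hN₀
  rw [RandAlg.pr_eq_uniformProb, IWDist.length_unaryEncodeNat''] at hgood
  have h1 := inv_le_pr_xF' p hNpos (hp _) (goodIdx L'' (gStr q j f pD (Nrep j m)) (kSeed j pD (Nrep j m)) (q.eval (Nrep j m)) (1 / 4)) hgood
  -- weaken `N^c` to `(N+1)^c`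
  have h0 : 1 / ((4 * (p.eval (Nrep j m) + 1) * (Nrep j m + 1) ^ c : ℕ) : ℝ) ≤
      1 / ((4 * (p.eval (Nrep j m) + 1) * Nrep j m ^ c : ℕ) : ℝ) := by
    refine one_div_le_one_div_of_le (by positivity) ?_
    exact_mod_cast Nat.mul_le_mul_left _ (Nat.pow_le_pow_left (Nat.le_succ _) c)
  refine h0.trans (h1.trans (uniformProb_mono_of_imp fun r hr => ?_))
  simp only [Set.mem_setOf_eq] at hr ⊢
  rw [smpF_apply]
  refine ⟨hn₀, ?_⟩
  have h2 := le_advantage_of_mem_goodIdx (Gfun q j f pD (hardLen j (Nrep j m))) L''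
    (eval_le_two_pow_Lx q j (N := Nrep j m) rfl) (z := xF' S p (boolPair (unaryEncodeNat (Nrep j m)) r)) (θ := 1 / 4)
    (t := q.eval (Nrep j m)) hr
  rw [hardLen_Nrep] at h2
  exact h2

/-- **IW98 Lemmas 13′–15 for this generator.** If `gStr` does not io-fool the weakly constructible
one-sided tests, then for some `L'' ∈ P` (with `FP` indicator `truncInd L''` of its truncation
language read by the evaluator) and some `n₀`, the approximating circuits `C^{f,1−2/D(m)}` relative to
`IWRecon.evalFnIdx (truncInd L'')` are probabilistic-polynomial-time constructible using `f_m` as an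
oracle, from any instance, at every hard length `m ≥ n₀`.
[cite: ImpagliazzoWigderson2001, Lemmas 13–15] [cite: CarmosinoImpagliazzoKabanetsKolokolova2016, Thm. 5.1] -/
theorem reducibleUsing_of_not_IOFools (hD1 : ∀ n, 1 ≤ pD.eval n)
    (hnot : ¬ IOFools (gStr q j f pD) (kSeed j pD) fun N => q.eval N) :
    ∃ L'' ∈ Classes.P, ∃ n₀ : ℕ, ReducibleUsing (fun m => {_z | n₀ ≤ m})
      (approxCircuits (IWRecon.evalFnIdx (truncInd L'')) f fun m => 2 / ((pD.eval m : ℕ) : ℝ)) f id := by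
  obtain ⟨L'', hL, S, p, c, n₁, hS, hhit⟩ := sampler_of_not_IOFools q j f pD hnot
  refine ⟨L'', hL, ?_⟩
  refine IWStage.reducibleUsing_sampled (LxF := LxF q j) (dL := truncInd L'') (SF := smpF q j S p) (LxF_mem_FP q j)
    (truncInd_mem_FP hL) (smpF_mem_FP q j hS p) (truncInd_apply L'') (Lx := Lx q j) (LxF_apply q j)
    (pD := pD) (pL := pL q j) (pR := (2 * p + 1).comp (X ^ 2 ^ j)) (pS := (4 * (p + 1) * (X + 1) ^ c).comp (X ^ 2 ^ j))
    hD1 (two_pow_Lx_le q j) (fun n => ?_) f (n₁ := n₁) (fun m hm n₀ hn₀ => ?_)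
  · simp only [eval_comp, eval_mul, eval_add, eval_pow, eval_X, eval_one, eval_ofNat]
    exact Nat.one_le_iff_ne_zero.2 (Nat.mul_ne_zero (Nat.mul_ne_zero (by norm_num) (by omega)) (pow_ne_zero _ (by omega)))
  · have h := hhit m hm n₀ hn₀
    have hR : ((2 * p + 1).comp (X ^ 2 ^ j)).eval m = (2 * p + 1).eval (Nrep j m) := by rw [eval_comp, eval_pow, eval_X, Nrep]
    have hSv : ((4 * (p + 1) * (X + 1) ^ c).comp (X ^ 2 ^ j)).eval m = 4 * (p.eval (Nrep j m) + 1) * (Nrep j m + 1) ^ c := by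
      simp only [eval_comp, eval_mul, eval_add, eval_pow, eval_X, eval_one, eval_ofNat, Nrep]
    rw [hR, hSv]
    exact h

end IWGen2

end Literature.Computability.Complexity

end

/-! ## Part: the table generator

# IW98 Case 2: the generator of the reconstruction fed with a truth table (a table generator in `FP`)

Literature / complexity — derandomization under a uniform assumption; sequel of
`IWReconstructionGenerator.lean`. The assembly of the printed proof packages a generator family as a
TABLE GENERATOR `σ ↦ (F ⟨tt(f_m), ⟨1^{Nb}, σ⟩⟩) ↾ᴰ q(N)` with `F ∈ FP` (`IWUniform.tableGen`,
`IWUniform.exists_tableGen_machine`: the truth table of the hard function at length `m = ⌊N^{2^{−j}}⌋`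
is written in time `2^{O(m^p)}`, then `F` runs in time polynomial in `2^m + |σ|`). Here the `FP`
function `F = IWGen2.genTT` for the generator `IWGen2.Gfun` of the reconstruction (NW with CIKK's design
on `AMP_{k(m)}(f_m)`), computed from the truth table by table lookups:

* `IWGen2.mU` — `1ᵐ` from the table (`|tt| = 2^m`, `m = |bin |tt|| − 1`); the parameter context;
* `IWGen2.fvalsF` — the `k` values `f(block_c(u))` of an `AMP` input `u`, by `k` lookups
  (`NWTable.lookupF`, `AmpEvalFP.blockFn`); `IWGen2.outPieceF` — output bit `i`: the restricted seed
  `u = σ|_{S_i}` (`NWDesignFP.restrictFn`, `restrictFn_eq_ofFn_cikkDesign`; index bits `bitsOfFn`),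
  then `AMP(f)(u)` (`LearnerTablesFP.entryFn`);
* **`IWGen2.genTT`** — the fold of the output pieces over `i < 2^{Lx m}` (`genTT_mem_FP`);
* **`IWGen2.genTT_apply`** — on `⟨truthTable (f ∘ ofFn), ⟨W, σ⟩⟩`:
  `genTT … = IWDist.genList (IWGen2.Gfun q j f pD m) σ`; hence `tableGen_genTT_eq`: the table generator
  IS the string generator `IWGen2.gStr` (`List.takeD = List.take`, the output being long enough).

Everything is proved; the definitions are explicit string functions (no named facts).

## References

* [ImpagliazzoWigderson2001] R. Impagliazzo, A. Wigderson, JCSS 63 (2001) 672–688, §2.1, §2.3.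
* [ImpagliazzoKabanetsWigderson2002] JCSS 65 (2002), Thm. 11 (the shape `G_r(s) = F(r, s)`).
* [AroraBarakCC2009] CUP 2009, Def. 20.12, proof of Thm. 20.6.
-/
noncomputable section

namespace Literature.Computability.Complexity

namespace IWGen2

open _root_.Computability Polynomial Brick Plumb HashBricks IWDist
  Literature.Computability.Learning Literature.Computability.MetaComplexity Literature.Computability.MetaComplexity.MCSPVerif

variable (q : Polynomial ℕ) (j : ℕ) (pD : Polynomial ℕ)

/-! ### Parameters read off the table -/

/-- `1ᵐ` on `Z = ⟨tt, ⟨W, σ⟩⟩` with `|tt| = 2^m`: drop one symbol of `bin |tt|` (of length `m + 1`). [folklore] -/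
def mU : List Bool → List Bool := onesFn ∘ dropFn ∘ fanoutFn (fun _ => ones 1) (lenBinF ∘ fstF)

/-- The stage context `⟨1ᵐ, σ⟩` on `Z`. [folklore] -/
def ctxU : List Bool → List Bool := fanoutFn mU (sndF ∘ sndF)

/-- `1ᵏ` on `Z`. [folklore] -/
def kU : List Bool → List Bool := IWStage.Params.kF pD ∘ mU

/-- `1^{fld}` on `Z` (the prime field size). [folklore] -/
def fldU : List Bool → List Bool := IWStage.qP (IWStage.Params.kF pD) ∘ ctxU

/-- `1^{km+k}` on `Z`. [folklore] -/
def knkU : List Bool → List Bool := IWStage.knkP (IWStage.Params.kF pD) ∘ ctxU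

/-- `1^{Lx}` on `Z`. [folklore] -/
def LxU : List Bool → List Bool := LxF q j ∘ mU

/-- `1^{2^{Lx}}` on `Z`. [folklore] -/
def LU : List Bool → List Bool := IWStage.Params.LF (pL q j) (LxF q j) ∘ mU

/-! ### The output piece -/

/-- The seed normalised to the universe size `fld²` on `Z`: `(σ ++ 0^{fld²}) ↾ fld²`. [folklore] -/
def zU : List Bool → List Bool :=
  takeFn ∘ fanoutFn (umulFn ∘ fanoutFn (fldU pD) (fldU pD))
    (appF ∘ fanoutFn (sndF ∘ sndF) (Kannan.zerosFn ∘ umulFn ∘ fanoutFn (fldU pD) (fldU pD)))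

/-- The restricted seed `u = σ|_{S_i}` on `⟨Z, 1ⁱ⟩`. [cite: AroraBarakCC2009, Def. 20.12] -/
def resU : List Bool → List Bool :=
  restrictFn ∘ fanoutFn
    (fanoutFn (fun _ => []) (fanoutFn (fldU pD ∘ fstF) (fanoutFn (LxU q j ∘ fstF)
      (fanoutFn (bitsOfFn ∘ fanoutFn (LxU q j ∘ fstF) sndF) (zU pD ∘ fstF)))))
    (knkU pD ∘ fstF)

/-- The lookup piece `c` on `⟨Y, 1ᶜ⟩`, `Y = ⟨⟨1ᵐ, u⟩, tt⟩`: the table bit at `block_c(u)`. [folklore] -/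
def lkPiece : List Bool → List Bool :=
  NWTable.lookupF ∘ fanoutFn (blockFn ∘ fanoutFn (fanoutFn (fstF ∘ fstF ∘ fstF) sndF) (sndF ∘ fstF ∘ fstF))
    (fanoutFn (sndF ∘ fstF) (fun _ => []))

/-- The `k` values `f(block_c(u))` on `Y' = ⟨⟨⟨1ᵐ, u⟩, tt⟩, 1ᵏ⟩`. [folklore] -/
def fvalsF : List Bool → List Bool :=
  sndPow 2 ∘ foldLoop appF (clipF 1 lkPiece) X ∘ fanoutFn fstF (fanoutFn (lenBinF ∘ sndF) (fun _ => boolPair [] []))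

/-- **Output bit `i`** on `⟨Z, 1ⁱ⟩`: `AMP(f)(σ|_{S_i})`. [cite: ImpagliazzoWigderson2001, §2.3] -/
def outPieceF : List Bool → List Bool :=
  entryFn ∘ fanoutFn (fanoutFn (fanoutFn (mU ∘ fstF) (kU pD ∘ fstF)) (resU q j pD))
    (fvalsF ∘ fanoutFn (fanoutFn (fanoutFn (mU ∘ fstF) (resU q j pD)) (fstF ∘ fstF)) (kU pD ∘ fstF))

/-- **The table generator of the reconstruction**: the fold of the output pieces over `i < 2^{Lx}`.
[cite: ImpagliazzoKabanetsWigderson2002, Thm. 11] [cite: AroraBarakCC2009, Def. 20.12] -/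
def genTT : List Bool → List Bool :=
  sndPow 2 ∘ foldLoop appF (clipF 1 (outPieceF q j pD)) (pL q j) ∘ fanoutFn (fun w => w) (fanoutFn (lenBinF ∘ LU q j) (fun _ => boolPair [] []))

/-! ### Membership in `FP` -/

/-- `mU ∈ FP`. [folklore] -/
theorem mU_mem_FP : mU ∈ FP :=
  comp_mem_FP onesFn_mem_FP (comp_mem_FP dropFn_mem_FP (fanoutFn_mem_FP (const_mem_FP _) (comp_mem_FP lenBinF_mem_FP fstF_mem_FP)))
/-- `ctxU ∈ FP`. [folklore] -/
theorem ctxU_mem_FP : ctxU ∈ FP := fanoutFn_mem_FP mU_mem_FP (comp_mem_FP sndF_mem_FP sndF_mem_FP)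
/-- `kU ∈ FP`. [folklore] -/
theorem kU_mem_FP : kU pD ∈ FP := comp_mem_FP (IWStage.Params.kF_mem_FP pD) mU_mem_FP
/-- `fldU ∈ FP`. [folklore] -/
theorem fldU_mem_FP : fldU pD ∈ FP := comp_mem_FP (IWStage.qP_mem_FP (IWStage.Params.kF_mem_FP pD)) ctxU_mem_FP
/-- `knkU ∈ FP`. [folklore] -/
theorem knkU_mem_FP : knkU pD ∈ FP := comp_mem_FP (IWStage.knkP_mem_FP (IWStage.Params.kF_mem_FP pD)) ctxU_mem_FP
/-- `LxU ∈ FP`. [folklore] -/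
theorem LxU_mem_FP : LxU q j ∈ FP := comp_mem_FP (LxF_mem_FP q j) mU_mem_FP
/-- `LU ∈ FP`. [folklore] -/
theorem LU_mem_FP : LU q j ∈ FP := comp_mem_FP (IWStage.Params.LF_mem_FP (pL q j) (LxF_mem_FP q j)) mU_mem_FP
/-- `zU ∈ FP`. [folklore] -/
theorem zU_mem_FP : zU pD ∈ FP := by
  have hM : (umulFn ∘ fanoutFn (fldU pD) (fldU pD)) ∈ FP := comp_mem_FP umulFn_mem_FP (fanoutFn_mem_FP (fldU_mem_FP pD) (fldU_mem_FP pD))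
  exact comp_mem_FP takeFn_mem_FP (fanoutFn_mem_FP hM (comp_mem_FP appF_mem_FP (fanoutFn_mem_FP (comp_mem_FP sndF_mem_FP sndF_mem_FP)
    (comp_mem_FP Kannan.zerosFn_mem_FP hM))))
/-- `resU ∈ FP`. [folklore] -/
theorem resU_mem_FP : resU q j pD ∈ FP :=
  comp_mem_FP restrictFn_mem_FP (fanoutFn_mem_FP
    (fanoutFn_mem_FP (const_mem_FP _) (fanoutFn_mem_FP (comp_mem_FP (fldU_mem_FP pD) fstF_mem_FP) (fanoutFn_mem_FP
      (comp_mem_FP (LxU_mem_FP q j) fstF_mem_FP) (fanoutFn_mem_FP (comp_mem_FP bitsOfFn_mem_FP (fanoutFn_mem_FP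
        (comp_mem_FP (LxU_mem_FP q j) fstF_mem_FP) sndF_mem_FP)) (comp_mem_FP (zU_mem_FP pD) fstF_mem_FP)))))
    (comp_mem_FP (knkU_mem_FP pD) fstF_mem_FP))
/-- `lkPiece ∈ FP`. [folklore] -/
theorem lkPiece_mem_FP : lkPiece ∈ FP :=
  comp_mem_FP NWTable.lookupF_mem_FP (fanoutFn_mem_FP (comp_mem_FP blockFn_mem_FP (fanoutFn_mem_FP
    (fanoutFn_mem_FP (comp_mem_FP fstF_mem_FP (comp_mem_FP fstF_mem_FP fstF_mem_FP)) sndF_mem_FP)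
    (comp_mem_FP sndF_mem_FP (comp_mem_FP fstF_mem_FP fstF_mem_FP))))
    (fanoutFn_mem_FP (comp_mem_FP sndF_mem_FP fstF_mem_FP) (const_mem_FP _)))
/-- The lookup piece has length `≤ 1`. [folklore] -/
theorem length_lkPiece_le (w : List Bool) : (lkPiece w).length ≤ 1 := by
  rw [lkPiece, Function.comp_apply]; exact NWTable.length_lookupF_le _
/-- `fvalsF ∈ FP`. [folklore] -/
theorem fvalsF_mem_FP : fvalsF ∈ FP :=
  comp_mem_FP (sndPow_mem_FP 2) (comp_mem_FP (foldLoop_clipF_mem_FP 1 appF_mem_FP length_appF_le lkPiece_mem_FP X)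
    (fanoutFn_mem_FP fstF_mem_FP (fanoutFn_mem_FP (comp_mem_FP lenBinF_mem_FP sndF_mem_FP) (const_mem_FP _))))
/-- `outPieceF ∈ FP`. [folklore] -/
theorem outPieceF_mem_FP : outPieceF q j pD ∈ FP :=
  comp_mem_FP entryFn_mem_FP (fanoutFn_mem_FP
    (fanoutFn_mem_FP (fanoutFn_mem_FP (comp_mem_FP mU_mem_FP fstF_mem_FP) (comp_mem_FP (kU_mem_FP pD) fstF_mem_FP)) (resU_mem_FP q j pD))
    (comp_mem_FP fvalsF_mem_FP (fanoutFn_mem_FP (fanoutFn_mem_FP (fanoutFn_mem_FP (comp_mem_FP mU_mem_FP fstF_mem_FP) (resU_mem_FP q j pD))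
      (comp_mem_FP fstF_mem_FP fstF_mem_FP)) (comp_mem_FP (kU_mem_FP pD) fstF_mem_FP))))
/-- The output piece has length `1`. [folklore] -/
theorem length_outPieceF (w : List Bool) : (outPieceF q j pD w).length = 1 := by
  simp only [outPieceF, entryFn, Function.comp_apply, fanoutFn_apply, HashBricks.andParityFn_boolPair, List.length_singleton]
/-- **`genTT ∈ FP`.** [cite: ImpagliazzoKabanetsWigderson2002, Thm. 11] -/
theorem genTT_mem_FP : genTT q j pD ∈ FP :=
  comp_mem_FP (sndPow_mem_FP 2) (comp_mem_FP
    (foldLoop_clipF_mem_FP 1 appF_mem_FP length_appF_le (outPieceF_mem_FP q j pD) (pL q j))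
    (fanoutFn_mem_FP (PolyTimeComputable.id _) (fanoutFn_mem_FP (comp_mem_FP lenBinF_mem_FP (LU_mem_FP q j)) (const_mem_FP _))))

/-! ### Values on a table input -/

section Values

variable {q j pD} (f : List Bool → Bool) (m : ℕ) (W σ : List Bool)

/-- The hard function at length `m`, on the cube. [folklore] -/
def fb (m : ℕ) : (Fin m → Bool) → Bool := fun v => f (List.ofFn v)

/-- The table input `Z = ⟨tt(f_m), ⟨W, σ⟩⟩`. [folklore] -/
def Zin : List Bool := boolPair (truthTable (fb f m)) (boolPair W σ)

/-- The amplification parameter of the file, abbreviated. [folklore] -/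
theorem kc_eq : kc pD m = IWStage.Params.kOf (fun n => pD.eval n) m := rfl

/-- Value of `mU`: `1ᵐ`. [folklore] -/
theorem mU_apply : mU (Zin f m W σ) = ones m := by
  rw [mU, Function.comp_apply, Function.comp_apply, fanoutFn_apply, Function.comp_apply, Zin, fstF_boolPair, lenBinF_apply,
    length_truthTable, dropFn_boolPair, onesFn_eq_ones, List.length_drop, TM2Pass.length_encodeNat_eq_size, Nat.size_pow]
  simp [ones]

/-- Value of `ctxU`: `⟨1ᵐ, σ⟩`. [folklore] -/
theorem ctxU_apply : ctxU (Zin f m W σ) = boolPair (ones m) σ := by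
  rw [ctxU, fanoutFn_apply, mU_apply]; simp [Zin]

/-- Value of `kU`: `1ᵏ`. [folklore] -/
theorem kU_apply : kU pD (Zin f m W σ) = ones (kc pD m) := by
  rw [kU, Function.comp_apply, mU_apply, IWStage.Params.kF_apply, kc_eq]

/-- Value of `fldU`: `1^{fld}`. [folklore] -/
theorem fldU_apply : fldU pD (Zin f m W σ) = ones (fld pD m) := by
  rw [fldU, Function.comp_apply, ctxU_apply, IWStage.qP_apply (IWStage.Params.kF_apply (pD := pD) m), fld, kc_eq]

/-- Value of `knkU`: `1^{km+k}`. [folklore] -/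
theorem knkU_apply : knkU pD (Zin f m W σ) = ones (kc pD m * m + kc pD m) := by
  rw [knkU, Function.comp_apply, ctxU_apply, IWStage.knkP_apply (IWStage.Params.kF_apply (pD := pD) m), kc_eq]

/-- Value of `LxU`: `1^{Lx}`. [folklore] -/
theorem LxU_apply : LxU q j (Zin f m W σ) = ones (Lx q j m) := by
  rw [LxU, Function.comp_apply, mU_apply, LxF_apply]

/-- Value of `LU`: `1^{2^{Lx}}`. [folklore] -/
theorem LU_apply : LU q j (Zin f m W σ) = ones (2 ^ Lx q j m) := by
  rw [LU, Function.comp_apply, mU_apply, IWStage.Params.LF_apply (LxF_apply q j) (two_pow_Lx_le q j)]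

/-- `ofFn (seedOf M σ) = (σ ++ 0^M) ↾ M`. [folklore] -/
theorem ofFn_seedOf (M : ℕ) : List.ofFn (seedOf M σ) = (σ ++ List.replicate M false).take M := by
  apply List.ext_getElem
  · simp
  · intro i h1 h2
    rw [List.length_ofFn] at h1
    rw [List.getElem_ofFn, List.getElem_take, seedOf]
    by_cases hi : i < σ.length
    · rw [List.getElem_append_left hi, List.getD_eq_getElem _ _ hi]
    · rw [List.getElem_append_right (not_lt.1 hi), List.getElem_replicate, List.getD_eq_default _ _ (not_lt.1 hi)]

/-- Value of `zU`: the normalised seed. [folklore] -/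
theorem zU_apply : zU pD (Zin f m W σ) = List.ofFn (seedOf (fld pD m * fld pD m) σ) := by
  rw [zU, Function.comp_apply, fanoutFn_apply, Function.comp_apply, fanoutFn_apply, fldU_apply, umulFn_boolPair, Function.comp_apply,
    fanoutFn_apply, Function.comp_apply, Function.comp_apply, Function.comp_apply, fanoutFn_apply, fldU_apply, umulFn_boolPair,
    Kannan.zerosFn_apply, takeFn_boolPair, appF_boolPair, ofFn_seedOf]
  simp [Zin, ones]

variable {m}

/-- **Value of `resU`**: the seed restricted to the `i`-th design block. [cite: AroraBarakCC2009, Def. 20.12] -/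
theorem resU_apply {i : ℕ} (hi : i < 2 ^ Lx q j m) :
    resU q j pD (boolPair (Zin f m W σ) (ones i)) =
      List.ofFn (seedOf (fld pD m * fld pD m) σ ∘
        learnerDesign (fld pD m) m (kc pD m) (Lx q j m) (IWStage.knk_le_qOf m (kc pD m)) ⟨i, hi⟩) := by
  rw [resU, Function.comp_apply, fanoutFn_apply]
  simp only [fanoutFn_apply, Function.comp_apply, fstF_boolPair, sndF_boolPair, fldU_apply, LxU_apply, knkU_apply, zU_apply,
    bitsOfFn_apply, Learning.ofFn_testBit_eq hi]
  exact restrictFn_eq_ofFn_cikkDesign [] (fld pD m) (kc pD m * m + kc pD m) (Lx q j m) (IWStage.knk_le_qOf m (kc pD m)) _ _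

/-- **Value of `fvalsF`**: the `k` table values at the blocks of an `AMP` input `u = ofFn uf`.
[cite: CarmosinoImpagliazzoKabanetsKolokolova2016, §5 (step 2)] -/
theorem fvalsF_apply (uf : Fin (kc pD m * m + kc pD m) → Bool) :
    fvalsF (boolPair (boolPair (boolPair (ones m) (List.ofFn uf)) (truthTable (fb f m))) (ones (kc pD m))) =
      List.ofFn fun c : Fin (kc pD m) => fb f m fun d => uf (ampIdxEquiv m (kc pD m) (Sum.inl (c, d))) := by
  set Y := boolPair (boolPair (ones m) (List.ofFn uf)) (truthTable (fb f m)) with hY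
  have hk : kc pD m ≤ X.eval Y.length := by
    rw [eval_X, hY, length_boolPair, length_boolPair, List.length_ofFn]; nlinarith
  rw [fvalsF, Function.comp_apply, Function.comp_apply, fanoutFn_apply, fanoutFn_apply, Function.comp_apply, fstF_boolPair,
    sndF_boolPair, lenBinF_apply, IWStage.Params.length_ones',
    show boolPair ([] : List Bool) [] = boolPair (ones 0) ([] : List Bool) from rfl,
    foldLoop_apply _ _ hk 0 [], foldAcc_clipF (fun c _ _ => (length_lkPiece_le _).trans (by omega)), foldAcc_appF]
  simp only [sndPow, Function.comp_apply, sndF_boolPair, zero_add, List.nil_append]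
  rw [ccat_congr (g' := fun c => [if h : c < kc pD m then fb f m (fun d => uf (ampIdxEquiv m (kc pD m) (Sum.inl (⟨c, h⟩, d)))) else false])
    (fun c hc => ?_), ccat_singleton_eq_ofFn]
  · exact congrArg List.ofFn (funext fun c => by rw [dif_pos c.isLt])
  · rw [dif_pos hc, lkPiece, Function.comp_apply, fanoutFn_apply]
    simp only [fanoutFn_apply, Function.comp_apply, fstF_boolPair, sndF_boolPair, hY]
    rw [blockFn_ofFn uf ⟨c, hc⟩, NWTable.lookupF_apply [] (by rw [length_truthTable]; simpa using bitsToNat_lt (List.ofFn fun d : Fin m => uf (ampIdxEquiv m (kc pD m) (Sum.inl (⟨c, hc⟩, d))))),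
      NWTable.getD_truthTable_bitsToNat_ofFn]

/-- **Value of the output piece**: `AMP(f)(σ|_{S_i})`, i.e. the `i`-th output bit of `Gfun`.
[cite: ImpagliazzoWigderson2001, §2.3] [cite: CarmosinoImpagliazzoKabanetsKolokolova2016, Thm. 4.3] -/
theorem outPieceF_apply {i : ℕ} (hi : i < 2 ^ Lx q j m) :
    outPieceF q j pD (boolPair (Zin f m W σ) (ones i)) = [Gfun q j f pD m (seedOf (fld pD m * fld pD m) σ) ⟨i, hi⟩] := by
  rw [outPieceF, Function.comp_apply, fanoutFn_apply]
  simp only [fanoutFn_apply, Function.comp_apply, fstF_boolPair, mU_apply, kU_apply, resU_apply f W σ hi]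
  rw [show fstF (Zin f m W σ) = truthTable (fb f m) by rw [Zin, fstF_boolPair], fvalsF_apply, entryFn_apply]
  rfl

/-- **Value of `genTT`**: the string generator of `Gfun`. [cite: ImpagliazzoKabanetsWigderson2002, Thm. 11] -/
theorem genTT_apply : genTT q j pD (Zin f m W σ) = genList (Gfun q j f pD m) σ := by
  have hL : 2 ^ Lx q j m ≤ (pL q j).eval (Zin f m W σ).length := by
    refine (two_pow_Lx_le q j m).trans (TM2Iter.eval_mono _ ?_)
    rw [Zin, length_boolPair, length_truthTable]
    have := @Nat.lt_two_pow_self m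
    omega
  rw [genTT, Function.comp_apply, Function.comp_apply, fanoutFn_apply, fanoutFn_apply, Function.comp_apply, LU_apply, lenBinF_apply,
    IWStage.Params.length_ones',
    show boolPair ([] : List Bool) [] = boolPair (ones 0) ([] : List Bool) from rfl,
    foldLoop_apply _ _ hL 0 [], foldAcc_clipF (fun i _ _ => (length_outPieceF q j pD _).le.trans (by omega)), foldAcc_appF]
  simp only [sndPow, Function.comp_apply, sndF_boolPair, zero_add, List.nil_append]
  rw [ccat_congr (g' := fun i => [if h : i < 2 ^ Lx q j m then Gfun q j f pD m (seedOf (fld pD m * fld pD m) σ) ⟨i, h⟩ else false])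
    (fun i hi => by rw [dif_pos hi, outPieceF_apply f W σ hi]), ccat_singleton_eq_ofFn, genList]
  exact congrArg List.ofFn (funext fun i => by rw [dif_pos i.isLt])

/-- **The table generator of the assembly IS the string generator of the reconstruction**:
`tableGen genTT (f ∘ ofFn at length m) Nb (q N) σ = gStr q j f pD N σ` for `m = hardLen j N`
(`takeD = take`, the output having `2^{Lx} ≥ q(N)` bits). [cite: ImpagliazzoWigderson2001, §2.1] -/
theorem tableGen_genTT_eq (N Nb : ℕ) (σ : List Bool) :
    IWUniform.tableGen (genTT q j pD) (fb f (hardLen j N)) Nb (q.eval N) σ = gStr q j f pD N σ := by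
  rw [IWUniform.tableGen, gStr]
  have h := genTT_apply (q := q) (j := j) (pD := pD) f (m := hardLen j N) (unaryEncodeNat Nb) σ
  rw [Zin] at h
  rw [h, List.takeD_eq_take]
  rw [genList, List.length_ofFn]
  exact eval_le_two_pow_Lx q j rfl

end Values

end IWGen2

end Literature.Computability.Complexity

end

/-! ## Part: the assembly

# IW98 Case 2 (`EXP ⊆ P/poly`, `EXP ≠ BPP`): the uniformly pseudorandom generator from a
# PSPACE-complete, downward-self-reducible, self-correctible function

Literature / complexity — derandomization under a uniform assumption (Impagliazzo–Wigderson 1998,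
Thm. 5 = van Melkebeek Thm. 6.2.1; the rendering `impagliazzoWigderson1998(_samplable)` of the tree is
discharged from the two generator constructions by `impagliazzoWigderson1998_samplable_of_generators`,
`UniformDerandomizationAssembly.lean`). This file closes the RECONSTRUCTION side of Case 2 (hypothesis
`h₂` of that assembly: `EXP ⊆ P/poly → BPP ≠ EXP → ∀ ε q, UniformPRGAt ε q`) from an explicit package of
facts about the hard function `f₀` — the PSPACE-complete problem of Trevisan–Vadhan Thm. 4.3 (IW98 use
a `#P`-complete and an `EXP`-complete function; TV07 §4 observe that one downward-self-reducible and
self-correctible PSPACE-complete `f₀` suffices under `EXP ⊆ P/poly`):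

* (F1) `IsHard PSPACE f₀`; (F2) `f₀ ∈ EXP` (time `2^{q₀(n)}` for the truth table);
* (F3) DOWNWARD SELF-REDUCIBILITY as an oracle machine (`M` computes `f₀` at length `n` from an oracle
  for `f₀` below `n`) — the hypothesis of IW Lemma 16 (`IWBootstrappingEventually.lean`);
* (F4) RANDOM SELF-REDUCIBILITY as randomized post-processing of descriptions: for every polynomial-time
  evaluator `Ev` there are a polynomial-time evaluator `Ev'` and an `FP` map `corr` such that from
  every `d ∈ C^{f,1−2/D(m)}_m` (relative to `Ev`, `m ≥ m₀`) `corr ⟨d, ⟨1ᵐ, ⟨1ᵃ, u⟩⟩⟩ ∈ C^f_m` (relative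
  to `Ev'`) for all but a `1/a` fraction of the coin strings `u ∈ {0,1}^{pc(m+a)}` (IW Def. 5,
  `C^{f,1−n^{−c}} → C^f`; TV07 Thm. 4.3, `TVSelfCorrect.lean`).

Given these, for every `ε > 0` and output polynomial `q`: the generator `IWGen2.gStr` (NW with CIKK's
design on `AMP_k(f_m)`, truth-table fed, `IWReconstructionGeneratorTable.lean`) is an
`IWUniform.UniformPRGAt ε q` — its matrices are decidable in time `2^{O(m^p)}·poly`
(`IWUniform.matrix_clause_tableGen`), and it io-fools the weakly constructible one-sided tests, for
otherwise (`IWGen2.reducibleUsing_of_not_IOFools`) `C^{f,1−2/D}` would be constructible using `fₘ`, then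
(`reducibleUsing_postCorrect`, (F4)) `C^f`, then (IW Lemma 16 with (F3),
`IWUniform.mem_BPP_of_dsr_of_eventually_stronglyConstructible`) `f₀ ∈ BPP`, contradicting (F1) under
`EXP ⊆ P/poly`, `BPP ≠ EXP` (`not_mem_BPP_of_isHard_PSPACE`).

* `IWGen2.reducibleUsing_postCorrect` — `A →^f C^{f,1−ρ}` composed with an (F4)-corrector gives
  `A →^f C^f` (from `m₀` on; `OracleAlg.prePost`, fibrewise counting);
* `IWGen2.eventually_strong_of_reducibleUsing` — a reduction from the trivial instance is a strong
  construction from a threshold on (`OracleAlg.comap`);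
* `IWGen2.goodIdx_pad`, `IWGen2.iOFools_pad` — padding the seed length does not change IW's classes;
* **`IWGen2.iOFools_gStr`**, **`IWGen2.uniformPRGAt_of_hardFunction`** — the Case-2 generator.

Everything is proved; (F1)–(F4) are hypotheses of the theorems (no named facts).

## References

* [ImpagliazzoWigderson2001] R. Impagliazzo, A. Wigderson, JCSS 63 (2001) 672–688, Thm. 5, §2
  (Lemmas 11–17, Defs. 2–5; held text pp. 4–9).
* [TrevisanVadhan2007] L. Trevisan, S. Vadhan, Comput. Complexity 16 (2007), §3 (Lemmas 3.4–3.6,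
  Thm. 3.9) and Thm. 4.3.
* [VanMelkebeek2000] D. van Melkebeek, LNCS 1950, Thm. 6.2.1 (p. 142).
-/
noncomputable section

namespace Literature.Computability.Complexity

namespace IWGen2

open _root_.Computability Polynomial Real Filter Brick Plumb HashBricks IWDist IWUniform
  Literature.Computability.Learning Literature.Computability.MetaComplexity

/-! ### Composing a reduction with a randomized post-processing of its outputs -/

section PostCorrect

variable (p pc : Polynomial ℕ) (corr : List Bool → List Bool)

/-- `1^{|z| + m + 2a}` on `w' = ⟨z, ⟨1ᵐ, ⟨1ᵃ, r⟩⟩⟩`. [folklore] -/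
def s2F : List Bool → List Bool := appF ∘ fanoutFn (onesFn ∘ fstF) (appF ∘ fanoutFn (nthF 1) (appF ∘ fanoutFn (nthF 2) (nthF 2)))
/-- `1^{m + 2a}` on `w'`. [folklore] -/
def m2F : List Bool → List Bool := appF ∘ fanoutFn (nthF 1) (appF ∘ fanoutFn (nthF 2) (nthF 2))
/-- The inner coins `r₁ = r ↾ p(|z|+m+2a)`. [folklore] -/
def r1F : List Bool → List Bool := takeFn ∘ fanoutFn (polyFn p ∘ s2F) (sndPow 2)
/-- The corrector's coins `r₂ = (r ⇂ p(|z|+m+2a)) ↾ pc(m+2a)`. [folklore] -/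
def r2F : List Bool → List Bool := takeFn ∘ fanoutFn (polyFn pc ∘ m2F) (dropFn ∘ fanoutFn (polyFn p ∘ s2F) (sndPow 2))
/-- **The pre-processing**: `w' ↦ ⟨z, ⟨1ᵐ, ⟨1^{2a}, r₁⟩⟩⟩` (accuracy doubled, inner coins). [folklore] -/
def preF : List Bool → List Bool :=
  fanoutFn fstF (fanoutFn (nthF 1) (fanoutFn (appF ∘ fanoutFn (nthF 2) (nthF 2)) (r1F p)))
/-- **The post-processing** on `⟨w', d⟩`: `corr ⟨d, ⟨1ᵐ, ⟨1^{2a}, r₂⟩⟩⟩`. [folklore] -/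
def postF : List Bool → List Bool :=
  corr ∘ fanoutFn sndF (fanoutFn (nthF 1 ∘ fstF) (fanoutFn (appF ∘ fanoutFn (nthF 2 ∘ fstF) (nthF 2 ∘ fstF)) (r2F p pc ∘ fstF)))

variable {p pc corr}

/-- `s2F ∈ FP`. [folklore] -/
theorem s2F_mem_FP : s2F ∈ FP :=
  comp_mem_FP appF_mem_FP (fanoutFn_mem_FP (comp_mem_FP onesFn_mem_FP fstF_mem_FP) (comp_mem_FP appF_mem_FP
    (fanoutFn_mem_FP (nthF_mem_FP 1) (comp_mem_FP appF_mem_FP (fanoutFn_mem_FP (nthF_mem_FP 2) (nthF_mem_FP 2))))))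
/-- `m2F ∈ FP`. [folklore] -/
theorem m2F_mem_FP : m2F ∈ FP :=
  comp_mem_FP appF_mem_FP (fanoutFn_mem_FP (nthF_mem_FP 1) (comp_mem_FP appF_mem_FP (fanoutFn_mem_FP (nthF_mem_FP 2) (nthF_mem_FP 2))))
/-- `r1F ∈ FP`. [folklore] -/
theorem r1F_mem_FP : r1F p ∈ FP := comp_mem_FP takeFn_mem_FP (fanoutFn_mem_FP (comp_mem_FP (polyFn_mem_FP p) s2F_mem_FP) (sndPow_mem_FP 2))
/-- `r2F ∈ FP`. [folklore] -/
theorem r2F_mem_FP : r2F p pc ∈ FP :=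
  comp_mem_FP takeFn_mem_FP (fanoutFn_mem_FP (comp_mem_FP (polyFn_mem_FP pc) m2F_mem_FP)
    (comp_mem_FP dropFn_mem_FP (fanoutFn_mem_FP (comp_mem_FP (polyFn_mem_FP p) s2F_mem_FP) (sndPow_mem_FP 2))))
/-- `preF ∈ FP`. [folklore] -/
theorem preF_mem_FP : preF p ∈ FP :=
  fanoutFn_mem_FP fstF_mem_FP (fanoutFn_mem_FP (nthF_mem_FP 1) (fanoutFn_mem_FP (comp_mem_FP appF_mem_FP
    (fanoutFn_mem_FP (nthF_mem_FP 2) (nthF_mem_FP 2))) r1F_mem_FP))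
/-- `postF ∈ FP` for `corr ∈ FP`. [folklore] -/
theorem postF_mem_FP (hc : corr ∈ FP) : postF p pc corr ∈ FP :=
  comp_mem_FP hc (fanoutFn_mem_FP sndF_mem_FP (fanoutFn_mem_FP (comp_mem_FP (nthF_mem_FP 1) fstF_mem_FP) (fanoutFn_mem_FP
    (comp_mem_FP appF_mem_FP (fanoutFn_mem_FP (comp_mem_FP (nthF_mem_FP 2) fstF_mem_FP) (comp_mem_FP (nthF_mem_FP 2) fstF_mem_FP)))
    (comp_mem_FP r2F_mem_FP fstF_mem_FP))))

variable (z : List Bool) (m a : ℕ) (r : List Bool)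

/-- `|1ᵐ| = m` (unary encoder). [folklore] -/
theorem length_unary (m : ℕ) : (unaryEncodeNat m).length = m := by
  rw [OracleCompose.unaryEncodeNat_eq_replicate, List.length_replicate]

/-- Fields of `w' = reduceInput z m a r`. [folklore] -/
theorem fields_reduceInput :
    fstF (reduceInput z m a r) = z ∧ nthF 1 (reduceInput z m a r) = unaryEncodeNat m ∧
      nthF 2 (reduceInput z m a r) = unaryEncodeNat a ∧ sndPow 2 (reduceInput z m a r) = r := by
  simp [reduceInput, strongInput, nthF, sndPow]

/-- Value of `s2F`. [folklore] -/
theorem s2F_apply : s2F (reduceInput z m a r) = ones (z.length + m + 2 * a) := by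
  obtain ⟨h0, h1, h2, -⟩ := fields_reduceInput z m a r
  simp only [s2F, Function.comp_apply, fanoutFn_apply, h0, h1, h2, appF_boolPair, onesFn_eq_ones, ones,
    OracleCompose.unaryEncodeNat_eq_replicate, List.replicate_append_replicate]
  congr 1; ring

/-- Value of `m2F`. [folklore] -/
theorem m2F_apply : m2F (reduceInput z m a r) = ones (m + 2 * a) := by
  obtain ⟨-, h1, h2, -⟩ := fields_reduceInput z m a r
  simp only [m2F, Function.comp_apply, fanoutFn_apply, h1, h2, appF_boolPair, OracleCompose.unaryEncodeNat_eq_replicate, ones,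
    List.replicate_append_replicate]
  congr 1; ring

/-- Value of `r1F`. [folklore] -/
theorem r1F_apply : r1F p (reduceInput z m a r) = r.take (p.eval (z.length + m + 2 * a)) := by
  obtain ⟨-, -, -, h3⟩ := fields_reduceInput z m a r
  rw [r1F, Function.comp_apply, fanoutFn_apply, Function.comp_apply, s2F_apply, polyFn_apply, h3, takeFn_boolPair]
  simp [ones]

/-- Value of `r2F`. [folklore] -/
theorem r2F_apply : r2F p pc (reduceInput z m a r) = (r.drop (p.eval (z.length + m + 2 * a))).take (pc.eval (m + 2 * a)) := by
  obtain ⟨-, -, -, h3⟩ := fields_reduceInput z m a r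
  rw [r2F, Function.comp_apply, fanoutFn_apply, Function.comp_apply, m2F_apply, polyFn_apply, Function.comp_apply, fanoutFn_apply,
    Function.comp_apply, s2F_apply, polyFn_apply, h3, dropFn_boolPair, takeFn_boolPair]
  simp [ones]

/-- **Value of the pre-processing**: the inner reduction input at accuracy `2a`. [folklore] -/
theorem preF_apply : preF p (reduceInput z m a r) = reduceInput z m (2 * a) (r.take (p.eval (z.length + m + 2 * a))) := by
  obtain ⟨h0, h1, h2, -⟩ := fields_reduceInput z m a r
  rw [preF, fanoutFn_apply, fanoutFn_apply, fanoutFn_apply, Function.comp_apply, fanoutFn_apply, h0, h1, h2, r1F_apply, appF_boolPair]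
  simp only [reduceInput, strongInput, OracleCompose.unaryEncodeNat_eq_replicate, List.replicate_append_replicate, two_mul]

/-- **Value of the post-processing**. [folklore] -/
theorem postF_apply (d : List Bool) :
    postF p pc corr (boolPair (reduceInput z m a r) d) =
      corr (boolPair d (boolPair (unaryEncodeNat m) (boolPair (unaryEncodeNat (2 * a))
        ((r.drop (p.eval (z.length + m + 2 * a))).take (pc.eval (m + 2 * a)))))) := by
  obtain ⟨-, h1, h2, -⟩ := fields_reduceInput z m a r
  rw [postF, Function.comp_apply]
  simp only [fanoutFn_apply, Function.comp_apply, fstF_boolPair, sndF_boolPair, h1, h2, r2F_apply, appF_boolPair,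
    OracleCompose.unaryEncodeNat_eq_replicate, List.replicate_append_replicate, two_mul]

/-- The pre-processed input is at most twice as long. [folklore] -/
theorem length_preF_le : (preF p (reduceInput z m a r)).length ≤ (2 * X : Polynomial ℕ).eval (reduceInput z m a r).length := by
  rw [preF_apply]
  simp only [reduceInput, strongInput, length_boolPair, length_unary, eval_mul, eval_ofNat, eval_X, List.length_take]
  omega

/-- `(1 − 1/(2a))² ≥ 1 − 1/a`. [folklore] -/
theorem one_sub_half_sq_ge {a : ℝ} (ha : 0 < a) : 1 - 1 / a ≤ (1 - 1 / (2 * a)) * (1 - 1 / (2 * a)) := by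
  have h : (1 - 1 / (2 * a)) * (1 - 1 / (2 * a)) = 1 - 1 / a + (1 / (2 * a)) ^ 2 := by
    field_simp; ring
  rw [h]
  linarith [sq_nonneg (1 / (2 * a))]

/-- **Composition of `A →^f C^{f,1−ρ}` with a randomized corrector** (IW: "using Def. 5,
`C^{f,1−n^{−c}}` is reducible to `C^f`", composed as in the proof of Lemma 17): if from `m₀` on, from
every description in `C^{f,1−ρ}_m` the corrector's output is in `C^f_m` (relative to `Ev'`) for all
but a `1/a` fraction of its `pc(m+a)` coins, then `C^f` is constructible from `A` using `fₘ` from `m₀`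
on. [cite: ImpagliazzoWigderson2001, Def. 5 and Lemma 17 (proof)] -/
theorem reducibleUsing_postCorrect {A : ConstructionProblem} {Ev Ev' corr : List Bool → List Bool} {f : List Bool → Bool}
    {ρ : ℕ → ℝ} (h : ReducibleUsing A (approxCircuits Ev f ρ) f id) (hc : corr ∈ FP) {pc : Polynomial ℕ} {m₀ : ℕ}
    (hgood : ∀ m, m₀ ≤ m → ∀ a : ℕ, 1 ≤ a → ∀ d ∈ approxCircuits Ev f ρ m,
      1 - 1 / (a : ℝ) ≤ uniformProb (pc.eval (m + a))
        {u | corr (boolPair d (boolPair (unaryEncodeNat m) (boolPair (unaryEncodeNat a) u))) ∈ Bootstrap.circuitsFor Ev' f m}) :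
    ReducibleUsing (fun m => A m ∩ {_z | m₀ ≤ m}) (Bootstrap.circuitsFor Ev' f) f id := by
  obtain ⟨C, b, p, hC, hrun⟩ := h
  refine ⟨C.prePost (preF p) (postF p pc corr), b.comp (2 * X), p.comp (2 * X) + pc.comp (2 * X),
    OracleAlg.isPolyTime_prePost hC preF_mem_FP (postF_mem_FP hc), fun m a ha z hz O hO => ?_⟩
  obtain ⟨hzA, hm₀⟩ := hz
  have ha2 : 1 ≤ 2 * a := by omega
  have har : (0 : ℝ) < a := by exact_mod_cast ha
  -- the coin budget splits as `L₁ + (L₂ + e)`, `L₁ = p(|z|+m+2a)`, `L₂ = pc(m+2a)`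
  have hle : p.eval (z.length + m + 2 * a) + pc.eval (m + 2 * a) ≤ (p.comp (2 * X) + pc.comp (2 * X)).eval (z.length + m + a) := by
    simp only [eval_add, eval_comp, eval_mul, eval_ofNat, eval_X]
    exact Nat.add_le_add (TM2Iter.eval_mono p (by omega)) (TM2Iter.eval_mono pc (by omega))
  obtain ⟨e, he⟩ := Nat.exists_eq_add_of_le hle
  rw [he, add_assoc]
  -- the inner run at accuracy `2a`, on the first `L₁` coins
  have hinner := hrun m (2 * a) ha2 z hzA O hO
  -- the target event contains "inner output approximates, corrector succeeds"
  have hsub : ∀ rr : List Bool, rr ∈ {rr : List Bool | ∃ d ∈ approxCircuits Ev f ρ m,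
      C.run O (b.eval (reduceInput z m (2 * a) (rr.take (p.eval (z.length + m + 2 * a)))).length)
          (reduceInput z m (2 * a) (rr.take (p.eval (z.length + m + 2 * a)))) = some d ∧
        corr (boolPair d (boolPair (unaryEncodeNat m) (boolPair (unaryEncodeNat (2 * a))
          ((rr.drop (p.eval (z.length + m + 2 * a))).take (pc.eval (m + 2 * a)))))) ∈ Bootstrap.circuitsFor Ev' f m} →
      rr ∈ {rr | ∃ z' ∈ Bootstrap.circuitsFor Ev' f m,
        (C.prePost (preF p) (postF p pc corr)).run O ((b.comp (2 * X)).eval (reduceInput z m a rr).length) (reduceInput z m a rr) =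
          some z'} := by
    rintro rr ⟨d, hd, hrunC, hcorr⟩
    refine ⟨_, hcorr, ?_⟩
    have hpre := preF_apply (p := p) z m a rr
    have hbud : b.eval (reduceInput z m (2 * a) (rr.take (p.eval (z.length + m + 2 * a)))).length ≤
        (b.comp (2 * X)).eval (reduceInput z m a rr).length := by
      rw [eval_comp, ← hpre]
      exact TM2Iter.eval_mono b (length_preF_le (p := p) z m a rr)
    have h1 := OracleAlg.run_mono C O _ hbud hrunC
    have h2 : (C.prePost (preF p) (postF p pc corr)).run O ((b.comp (2 * X)).eval (reduceInput z m a rr).length) (reduceInput z m a rr) =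
        (C.run O ((b.comp (2 * X)).eval (reduceInput z m a rr).length) (preF p (reduceInput z m a rr))).map
          fun d' => postF p pc corr (boolPair (reduceInput z m a rr) d') :=
      OracleAlg.runAux_prePost C (preF p) (postF p pc corr) O _ _ []
    rw [h2, hpre, h1, Option.map_some, postF_apply]
  refine le_trans ?_ (uniformProb_mono_of_imp hsub)
  -- fibrewise over the inner coins
  have hfib := le_uniformProb_add_of_fibre (a := p.eval (z.length + m + 2 * a)) (k := pc.eval (m + 2 * a) + e)
    (S := {r₁ : List Bool | ∃ d ∈ approxCircuits Ev f ρ m,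
      C.run O (b.eval (reduceInput z m (2 * a) r₁).length) (reduceInput z m (2 * a) r₁) = some d})
    (E := {rr : List Bool | ∃ d ∈ approxCircuits Ev f ρ m,
      C.run O (b.eval (reduceInput z m (2 * a) (rr.take (p.eval (z.length + m + 2 * a)))).length)
          (reduceInput z m (2 * a) (rr.take (p.eval (z.length + m + 2 * a)))) = some d ∧
        corr (boolPair d (boolPair (unaryEncodeNat m) (boolPair (unaryEncodeNat (2 * a))
          ((rr.drop (p.eval (z.length + m + 2 * a))).take (pc.eval (m + 2 * a)))))) ∈ Bootstrap.circuitsFor Ev' f m})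
    (B := 1 - 1 / ((2 * a : ℕ) : ℝ)) fun Y hY hYS => ?_
  · refine le_trans ?_ hfib
    have hS : 1 - 1 / ((2 * a : ℕ) : ℝ) ≤ uniformProb (p.eval (z.length + m + 2 * a)) {r₁ : List Bool | ∃ d ∈ approxCircuits Ev f ρ m,
        C.run O (b.eval (reduceInput z m (2 * a) r₁).length) (reduceInput z m (2 * a) r₁) = some d} := hinner
    have hB0 : (0 : ℝ) ≤ 1 - 1 / ((2 * a : ℕ) : ℝ) := by
      rw [sub_nonneg, div_le_one (by positivity)]; exact_mod_cast ha2
    calc 1 - 1 / (a : ℝ) ≤ (1 - 1 / (2 * (a : ℝ))) * (1 - 1 / (2 * (a : ℝ))) := one_sub_half_sq_ge har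
      _ = (1 - 1 / ((2 * a : ℕ) : ℝ)) * (1 - 1 / ((2 * a : ℕ) : ℝ)) := by push_cast; ring
      _ ≤ _ := mul_le_mul_of_nonneg_right hS hB0
  · -- on a good inner fibre the corrector succeeds on its own coins
    obtain ⟨d, hd, hrunY⟩ := hYS
    have hset : ∀ v : List Bool, v ∈ {v : List Bool | v.take (pc.eval (m + 2 * a)) ∈
        {u | corr (boolPair d (boolPair (unaryEncodeNat m) (boolPair (unaryEncodeNat (2 * a)) u))) ∈ Bootstrap.circuitsFor Ev' f m}} →
        v ∈ {v : List Bool | Y ++ v ∈ {rr : List Bool | ∃ d ∈ approxCircuits Ev f ρ m,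
          C.run O (b.eval (reduceInput z m (2 * a) (rr.take (p.eval (z.length + m + 2 * a)))).length)
              (reduceInput z m (2 * a) (rr.take (p.eval (z.length + m + 2 * a)))) = some d ∧
            corr (boolPair d (boolPair (unaryEncodeNat m) (boolPair (unaryEncodeNat (2 * a))
              ((rr.drop (p.eval (z.length + m + 2 * a))).take (pc.eval (m + 2 * a)))))) ∈ Bootstrap.circuitsFor Ev' f m}} := by
      intro v hv
      simp only [Set.mem_setOf_eq] at hv ⊢
      refine ⟨d, hd, ?_, ?_⟩
      · rw [List.take_append_of_le_length hY.ge, List.take_of_length_le hY.le]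
        exact hrunY
      · rw [List.drop_append_of_le_length hY.ge, List.drop_of_length_le hY.le, List.nil_append]
        exact hv
    refine le_trans ?_ (uniformProb_mono_of_imp hset)
    rw [uniformProb_take_add]
    exact hgood m hm₀ (2 * a) ha2 d hd

end PostCorrect

/-! ### From a reduction from the trivial instance to a strong construction from a threshold on -/

/-- Prefixing the empty instance: `w ↦ ⟨ε, w⟩`. [folklore] -/
def nilInst : List Bool → List Bool := fanoutFn (fun _ => []) fun w => w

/-- `nilInst ∈ FP`. [folklore] -/
theorem nilInst_mem_FP : nilInst ∈ FP := fanoutFn_mem_FP (const_mem_FP _) (PolyTimeComputable.id _)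

/-- Value of `nilInst`. [folklore] -/
theorem nilInst_apply (w : List Bool) : nilInst w = boolPair [] w := by simp [nilInst, fanoutFn_apply]

/-- **A reduction from the instance `ε` is a strong construction** (from `n₀` on): pre-process
`⟨1ⁿ, ⟨1ᵃ, r⟩⟩ ↦ ⟨ε, ⟨1ⁿ, ⟨1ᵃ, r⟩⟩⟩` (`OracleAlg.comap`). [cite: ImpagliazzoWigderson2001, §2.2] -/
theorem eventually_strong_of_reducibleUsing {A B : ConstructionProblem} {f : List Bool → Bool} {n₀ : ℕ}
    (h : ReducibleUsing A B f id) (hA : ∀ n : ℕ, n₀ ≤ n → ([] : List Bool) ∈ A n) :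
    ∃ (C : OracleAlg (List Bool)) (b p : Polynomial ℕ), C.IsPolyTime (encodingList Bool) ∧
      ∀ n : ℕ, n₀ ≤ n → ∀ a : ℕ, 1 ≤ a → ∀ O : Oracle, AgreesOn O f n →
        1 - 1 / (a : ℝ) ≤ uniformProb (p.eval (n + a))
          {r | ∃ z ∈ B n, C.run O (b.eval (strongInput n a r).length) (strongInput n a r) = some z} := by
  obtain ⟨C, b, p, hC, hrun⟩ := h
  refine ⟨C.comap nilInst, b.comp (X + 2), p, OracleAlg.isPolyTime_comap (encodingList Bool) hC nilInst_mem_FP,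
    fun n hn a ha O hO => ?_⟩
  have h := hrun n a ha [] (hA n hn) O hO
  rw [List.length_nil, zero_add] at h
  refine h.trans (uniformProb_mono_of_imp ?_)
  rintro r ⟨z, hz, hrunz⟩
  refine ⟨z, hz, ?_⟩
  have h1 : (C.comap nilInst).run O ((b.comp (X + 2)).eval (strongInput n a r).length) (strongInput n a r) =
      C.run O ((b.comp (X + 2)).eval (strongInput n a r).length) (nilInst (strongInput n a r)) :=
    OracleAlg.runAux_comap C nilInst O _ _ []
  have hlen : (b.comp (X + 2)).eval (strongInput n a r).length = b.eval (reduceInput [] n a r).length := by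
    rw [eval_comp, reduceInput, length_boolPair]; simp [add_comm]
  rw [h1, nilInst_apply, hlen]
  exact hrunz

/-! ### Padding the seed length -/

/-- The string generator reads only the first `fld²` seed bits. [folklore] -/
theorem genList_take {M L : ℕ} (G : (Fin M → Bool) → (Fin L → Bool)) (s : List Bool) : genList G (s.take M) = genList G s := by
  rw [genList, genList]
  congr 2
  funext i
  simp only [seedOf, List.getD_eq_getElem?_getD, List.getElem?_take, if_pos i.isLt]

variable (q : Polynomial ℕ) (j : ℕ) (f : List Bool → Bool) (pD : Polynomial ℕ)

/-- `gStr` reads only the first `kSeed` seed bits. [folklore] -/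
theorem gStr_take (N : ℕ) (s : List Bool) : gStr q j f pD N (s.take (kSeed j pD N)) = gStr q j f pD N s := by
  rw [gStr, gStr, kSeed, genList_take]

/-- **Padding the seed length does not change IW's class of distinguishing indices.** [folklore] -/
theorem goodIdx_pad (L'' : Language Bool) (N e t : ℕ) (θ : ℝ) :
    goodIdx L'' (gStr q j f pD N) (kSeed j pD N + e) t θ = goodIdx L'' (gStr q j f pD N) (kSeed j pD N) t θ := by
  ext z
  rw [mem_goodIdx_iff, mem_goodIdx_iff, gap, gap]
  have hset : {s : List Bool | gStr q j f pD N s ∈ test L'' (fstF z) ((sndF z).headD false)} =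
      {s | s.take (kSeed j pD N) ∈ {s' : List Bool | gStr q j f pD N s' ∈ test L'' (fstF z) ((sndF z).headD false)}} := by
    ext s; simp only [Set.mem_setOf_eq, gStr_take]
  conv_lhs => rw [hset, uniformProb_take_add]

/-- Hence `IOFools` for the padded seed length is `IOFools` for `kSeed`. [folklore] -/
theorem iOFools_pad {kS : ℕ → ℕ} (hk : ∀ N, kSeed j pD N ≤ kS N) :
    IOFools (gStr q j f pD) kS (fun N => q.eval N) ↔ IOFools (gStr q j f pD) (kSeed j pD) fun N => q.eval N := by
  have hset : ∀ (L'' : Language Bool) N, goodIdx L'' (gStr q j f pD N) (kS N) (q.eval N) (1 / 4) =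
      goodIdx L'' (gStr q j f pD N) (kSeed j pD N) (q.eval N) (1 / 4) := fun L'' N => by
    obtain ⟨e, he⟩ := Nat.exists_eq_add_of_le (hk N)
    rw [he, goodIdx_pad]
  simp only [IOFools, hset]

/-! ### The Case-2 generator -/

section Assembly

/-- The hard function as a Boolean function on strings. [folklore] -/
def hardFn (f₀ : Language Bool) : List Bool → Bool := fun w => f₀.boolIndicator w

/-- On the cube, `hardFn` is the slice function fed to the table generator. [folklore] -/
theorem fb_hardFn (f₀ : Language Bool) (m : ℕ) : fb (hardFn f₀) m = f₀.sliceFn m := rfl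

/-- The language of `hardFn f₀` is `f₀`. [folklore] -/
theorem setOf_hardFn (f₀ : Language Bool) : {x | hardFn f₀ x = true} = f₀ := by
  ext x
  rw [Set.mem_setOf_eq, hardFn]
  exact ⟨fun h => (Set.mem_iff_boolIndicator _ _).2 h, fun h => (Set.mem_iff_boolIndicator _ _).1 h⟩

/-- The seed range `0^{K m^{sx} + K}` is `FP`-producible. [folklore] -/
theorem fpProducer_seed_add (K sx j : ℕ) : NKannan.FPProducer fun n => K * (Nat.sqrt^[j] n) ^ sx + K :=
  ⟨Kannan.zerosFn ∘ appF ∘ fanoutFn (IKWSim.kF K sx j) (fun _ => ones K),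
    comp_mem_FP Kannan.zerosFn_mem_FP (comp_mem_FP appF_mem_FP (fanoutFn_mem_FP (IKWSim.kF_mem_FP K sx j) (const_mem_FP _))),
    fun x => by simp [fanoutFn_apply, ones]⟩

/-- `m^a ≤ m^b + 1` for `a ≤ b`. [folklore] -/
theorem pow_le_pow_add_one_of_le' {m a b : ℕ} (h : a ≤ b) : m ^ a ≤ m ^ b + 1 := by
  rcases Nat.eq_zero_or_pos m with rfl | hm
  · rcases Nat.eq_zero_or_pos a with rfl | ha
    · simp
    · rw [zero_pow (Nat.pos_iff_ne_zero.1 ha)]; exact Nat.zero_le _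
  · exact (Nat.pow_le_pow_right hm h).trans (Nat.le_succ _)

/-- **The field size is polynomially bounded**: `fld(m)² ≤ K m^{sx} + K`. [folklore] -/
theorem exists_fld_sq_le (pD : Polynomial ℕ) : ∃ K sx : ℕ, ∀ m, fld pD m * fld pD m ≤ K * m ^ sx + K := by
  obtain ⟨K, sx, hK⟩ := exists_eval_le_mul_pow_add ((2 * (IWStage.Params.pK pD * X + IWStage.Params.pK pD)) ^ 2)
  refine ⟨K, sx, fun m => le_trans ?_ (hK m)⟩
  have hk := IWStage.Params.kOf_le_pK (D := fun n => pD.eval n) (pD := pD) (fun n => le_rfl) m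
  have hq : fld pD m ≤ 2 * (IWStage.Params.kOf (fun n => pD.eval n) m * m + IWStage.Params.kOf (fun n => pD.eval n) m) := by
    rw [fld, kc, IWStage.qOf]
    exact prmQ_le _ (by have := IWStage.Params.kOf_pos (D := fun n => pD.eval n) m; positivity)
  have hq' : fld pD m ≤ (2 * (IWStage.Params.pK pD * X + IWStage.Params.pK pD)).eval m := by
    simp only [eval_mul, eval_add, eval_X, eval_ofNat]
    exact hq.trans (by gcongr)
  rw [eval_pow, pow_two]
  exact Nat.mul_le_mul hq' hq'

variable {f₀ : Language Bool} (hEXP : EXP ⊆ PPoly) (hne : BPP ≠ EXP) (hHard : IsHard PSPACE f₀)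
  (hDSR : ∃ (M : OracleAlg (List Bool)) (bM : Polynomial ℕ), M.IsPolyTime (encodingList Bool) ∧
    ∀ (x : List Bool) (O : Oracle), (∀ y : List Bool, y.length < x.length → O y = [hardFn f₀ y]) →
      M.run O (bM.eval x.length) x = some [hardFn f₀ x])
  {pD : Polynomial ℕ} (hD1 : ∀ n, 1 ≤ pD.eval n)
  (hRSR : ∀ Ev : List Bool → List Bool, Ev ∈ FP → ∃ Ev' corr : List Bool → List Bool, Ev' ∈ FP ∧ corr ∈ FP ∧
    ∃ (pc : Polynomial ℕ) (m₀ : ℕ), ∀ m, m₀ ≤ m → ∀ a : ℕ, 1 ≤ a →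
      ∀ d ∈ approxCircuits Ev (hardFn f₀) (fun m => 2 / ((pD.eval m : ℕ) : ℝ)) m,
        1 - 1 / (a : ℝ) ≤ uniformProb (pc.eval (m + a))
          {u | corr (boolPair d (boolPair (unaryEncodeNat m) (boolPair (unaryEncodeNat a) u))) ∈ Bootstrap.circuitsFor Ev' (hardFn f₀) m})

include hEXP hne hHard hDSR hD1 hRSR in
/-- **The generator of the reconstruction io-fools the weakly constructible one-sided tests.**
Otherwise `C^{f,1−2/D}` would be constructible using `fₘ` (`reducibleUsing_of_not_IOFools`), hence
`C^f` ((F4), `reducibleUsing_postCorrect`), hence `f₀ ∈ BPP` (IW Lemma 16 with (F3)), contradicting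
(F1) under `EXP ⊆ P/poly` and `BPP ≠ EXP`.
[cite: ImpagliazzoWigderson2001, Lemmas 13–17 and Thm. 5 (Case `EXP ⊂ P/poly`)] [cite: TrevisanVadhan2007, §3 and Thm. 4.3] -/
theorem iOFools_gStr (q : Polynomial ℕ) (j : ℕ) : IOFools (gStr q j (hardFn f₀) pD) (kSeed j pD) fun N => q.eval N := by
  by_contra hnot
  obtain ⟨L'', hL, n₀, hred⟩ := reducibleUsing_of_not_IOFools q j (hardFn f₀) pD hD1 hnot
  obtain ⟨Ev', corr, hEv', hcorr, pc, m₀, hgood⟩ := hRSR (IWRecon.evalFnIdx (truncInd L'')) (IWRecon.evalFnIdx_mem_FP _ (truncInd_mem_FP hL))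
  have hred2 := reducibleUsing_postCorrect hred hcorr hgood
  obtain ⟨C, b, p, hC, hstrong⟩ := eventually_strong_of_reducibleUsing (n₀ := max n₀ m₀) hred2
    (fun n hn => ⟨le_trans (le_max_left _ _) hn, le_trans (le_max_right _ _) hn⟩)
  obtain ⟨M, bM, hM, hdsr⟩ := hDSR
  have hBPP := IWUniform.mem_BPP_of_dsr_of_eventually_stronglyConstructible hEv' ⟨C, b, p, max n₀ m₀, hC, hstrong⟩ hM hdsr
  rw [setOf_hardFn] at hBPP
  exact not_mem_BPP_of_isHard_PSPACE hEXP hne hHard hBPP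

include hEXP hne hHard hDSR hD1 hRSR in
/-- **IW98, Case 2: the uniformly pseudorandom generator** (`IWUniform.UniformPRGAt ε q` for every
`ε > 0` and every output polynomial `q`) from a PSPACE-hard `f₀ ∈ EXP` that is downward self-reducible
(F3) and random self-reducible (F4) in the machine forms above: the truth-table-fed NW generator with
CIKK's design on `AMP_k(f_m)`, `m = ⌊N^{2^{−j}}⌋`, seeds `O(m^p)`, matrices decidable in time
`2^{O(m^p)}·poly` (`IWUniform.matrix_clause_tableGen`), io-fooling by `iOFools_gStr`.
[cite: ImpagliazzoWigderson2001, Thm. 5 and §2] [cite: VanMelkebeek2000, Thm. 6.2.1 (p. 142)] -/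
theorem uniformPRGAt_of_hardFunction (hf₀E : f₀ ∈ EXP) {ε : ℝ} (hε : 0 < ε) (q : Polynomial ℕ) : UniformPRGAt ε q := by
  classical
  obtain ⟨q₀, hdec⟩ := exists_two_pow_eval_of_mem_EXP hf₀E
  obtain ⟨K₀, k₀, hq₀⟩ := exists_eval_le_mul_pow_add q₀
  obtain ⟨Ks, sx, hKs⟩ := exists_fld_sq_le pD
  obtain ⟨j, hjε⟩ := exists_root_depth (k₀ + sx + 1) hε
  have hp1 : 1 ≤ k₀ + sx + 1 := by omega
  have hq₀' : ∀ m, q₀.eval m ≤ 2 * K₀ * m ^ (k₀ + sx + 1) + 2 * K₀ := fun m => by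
    have h1 := hq₀ m
    have h2 : K₀ * m ^ k₀ ≤ K₀ * (m ^ (k₀ + sx + 1) + 1) := Nat.mul_le_mul_left K₀ (pow_le_pow_add_one_of_le' (by omega))
    rw [Nat.mul_add, Nat.mul_one] at h2
    have h3 : 2 * K₀ * m ^ (k₀ + sx + 1) + 2 * K₀ = (K₀ * m ^ (k₀ + sx + 1) + K₀) + (K₀ * m ^ (k₀ + sx + 1) + K₀) := by ring
    omega
  have hkK : ∃ K, ∀ n, Ks * (Nat.sqrt^[j] n) ^ sx + Ks ≤ K * (Nat.sqrt^[j] n) ^ (k₀ + sx + 1) + K :=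
    ⟨2 * Ks, fun n => by
      have h2 : Ks * (Nat.sqrt^[j] n) ^ sx ≤ Ks * ((Nat.sqrt^[j] n) ^ (k₀ + sx + 1) + 1) :=
        Nat.mul_le_mul_left Ks (pow_le_pow_add_one_of_le' (by omega))
      rw [Nat.mul_add, Nat.mul_one] at h2
      have h3 : 2 * Ks * (Nat.sqrt^[j] n) ^ (k₀ + sx + 1) + 2 * Ks =
          (Ks * (Nat.sqrt^[j] n) ^ (k₀ + sx + 1) + Ks) + (Ks * (Nat.sqrt^[j] n) ^ (k₀ + sx + 1) + Ks) := by ring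
      omega⟩
  -- the generator (table form) and its identification with `gStr`
  have hg : (fun n => tableGen (genTT q j pD) (f₀.sliceFn (Nat.sqrt^[j] n)) ((0 : Polynomial ℕ).eval n) (q.eval n)) =
      gStr q j (hardFn f₀) pD := by
    funext N σ
    rw [← fb_hardFn]
    exact tableGen_genTT_eq (q := q) (j := j) (pD := pD) (hardFn f₀) N _ σ
  refine ⟨fun n => tableGen (genTT q j pD) (f₀.sliceFn (Nat.sqrt^[j] n)) ((0 : Polynomial ℕ).eval n) (q.eval n),
    fun n => Ks * (Nat.sqrt^[j] n) ^ sx + Ks, k₀ + sx + 1, j, by exact_mod_cast hjε, fpProducer_seed_add Ks sx j, hkK,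
    fun L' hL' => matrix_clause_tableGen (genTT_mem_FP q j pD) hdec hp1 hq₀' 0 q hkK hL', ?_⟩
  rw [hg, iOFools_pad q j (hardFn f₀) pD (fun N => by rw [kSeed]; exact hKs _)]
  exact iOFools_gStr hEXP hne hHard hDSR hD1 hRSR q j

/-! ### The fact from the hard function -/

/-- **`impagliazzoWigderson1998_samplable` (van Melkebeek Thm. 6.2.1 = IW98 Thm. 5) from the F-side
package alone.** Case 1 (`EXP ⊄ P/poly`) is Babai–Fortnow–Nisan–Wigderson's i.o. generator
(`IWUniform.ioPRGAt_of_not_EXP_subset_PPoly`, in the tree); Case 2 is `uniformPRGAt_of_hardFunction`;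
the two are assembled by `impagliazzoWigderson1998_samplable_of_generators`. What remains hypothetical is
exactly Trevisan–Vadhan's Thm. 4.3 in machine form: a PSPACE-hard `f₀ ∈ EXP`, downward self-reducible
by a polynomial-time oracle machine and random self-reducible by polynomial-time post-processing of
approximating descriptions. [cite: VanMelkebeek2000, Thm. 6.2.1 (p. 142)] [cite: ImpagliazzoWigderson2001, Thm. 5]
[cite: TrevisanVadhan2007, Thm. 3.9 and Thm. 4.3] -/
theorem _root_.Literature.Computability.Complexity.impagliazzoWigderson1998_samplable_of_hardFunction
    (hF : ∃ (f₀ : Language Bool) (pD : Polynomial ℕ), IsHard PSPACE f₀ ∧ f₀ ∈ EXP ∧ (∀ n, 1 ≤ pD.eval n) ∧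
      (∃ (M : OracleAlg (List Bool)) (bM : Polynomial ℕ), M.IsPolyTime (encodingList Bool) ∧
        ∀ (x : List Bool) (O : Oracle), (∀ y : List Bool, y.length < x.length → O y = [hardFn f₀ y]) →
          M.run O (bM.eval x.length) x = some [hardFn f₀ x]) ∧
      (∀ Ev : List Bool → List Bool, Ev ∈ FP → ∃ Ev' corr : List Bool → List Bool, Ev' ∈ FP ∧ corr ∈ FP ∧
        ∃ (pc : Polynomial ℕ) (m₀ : ℕ), ∀ m, m₀ ≤ m → ∀ a : ℕ, 1 ≤ a →
          ∀ d ∈ approxCircuits Ev (hardFn f₀) (fun m => 2 / ((pD.eval m : ℕ) : ℝ)) m,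
            1 - 1 / (a : ℝ) ≤ uniformProb (pc.eval (m + a))
              {u | corr (boolPair d (boolPair (unaryEncodeNat m) (boolPair (unaryEncodeNat a) u))) ∈
                Bootstrap.circuitsFor Ev' (hardFn f₀) m})) :
    impagliazzoWigderson1998_samplable := by
  obtain ⟨f₀, pD, hHard, hE, hD1, hDSR, hRSR⟩ := hF
  exact impagliazzoWigderson1998_samplable_of_generators
    (fun h ε hε L' hL' q => ioPRGAt_of_not_EXP_subset_PPoly h hε hL' q)
    (fun hEXP hne ε hε q => uniformPRGAt_of_hardFunction hEXP hne hHard hDSR hD1 hRSR hE hε q)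

/-- The same for the printed-class rendering `impagliazzoWigderson1998`. [cite: VanMelkebeek2000, Thm. 6.2.1 (p. 142)]
[cite: ImpagliazzoWigderson2001, Thm. 5] -/
theorem _root_.Literature.Computability.Complexity.impagliazzoWigderson1998_of_hardFunction
    (hF : ∃ (f₀ : Language Bool) (pD : Polynomial ℕ), IsHard PSPACE f₀ ∧ f₀ ∈ EXP ∧ (∀ n, 1 ≤ pD.eval n) ∧
      (∃ (M : OracleAlg (List Bool)) (bM : Polynomial ℕ), M.IsPolyTime (encodingList Bool) ∧
        ∀ (x : List Bool) (O : Oracle), (∀ y : List Bool, y.length < x.length → O y = [hardFn f₀ y]) →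
          M.run O (bM.eval x.length) x = some [hardFn f₀ x]) ∧
      (∀ Ev : List Bool → List Bool, Ev ∈ FP → ∃ Ev' corr : List Bool → List Bool, Ev' ∈ FP ∧ corr ∈ FP ∧
        ∃ (pc : Polynomial ℕ) (m₀ : ℕ), ∀ m, m₀ ≤ m → ∀ a : ℕ, 1 ≤ a →
          ∀ d ∈ approxCircuits Ev (hardFn f₀) (fun m => 2 / ((pD.eval m : ℕ) : ℝ)) m,
            1 - 1 / (a : ℝ) ≤ uniformProb (pc.eval (m + a))
              {u | corr (boolPair d (boolPair (unaryEncodeNat m) (boolPair (unaryEncodeNat a) u))) ∈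
                Bootstrap.circuitsFor Ev' (hardFn f₀) m})) :
    impagliazzoWigderson1998 := by
  obtain ⟨f₀, pD, hHard, hE, hD1, hDSR, hRSR⟩ := hF
  exact impagliazzoWigderson1998_of_generators
    (fun h ε hε L' hL' q => ioPRGAt_of_not_EXP_subset_PPoly h hε hL' q)
    (fun hEXP hne ε hε q => uniformPRGAt_of_hardFunction hEXP hne hHard hDSR hD1 hRSR hE hε q)

/-! ### Specialisation to Trevisan–Vadhan's language `LTV` -/

/-- **`impagliazzoWigderson1998_samplable` from Trevisan–Vadhan's `LTV`**, whose `PSPACE`-hardness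
(`TVHard.isHard_PSPACE_LTV`), downward self-reduction machine (`TVChk.dsrAlg_run`) and exponential
time bound (`QBFUniv.LTV_mem_EXP`) are in the tree: what remains hypothetical is the random
self-reduction as polynomial-time post-processing of approximating descriptions (TV07 Thm. 4.3,
self-correctibility; `TVSelfCorrect.lean`/`TVSelfCorrectMajority.lean` have the counting).
[cite: TrevisanVadhan2007, Thm. 4.3 and Thm. 3.9] [cite: VanMelkebeek2000, Thm. 6.2.1 (p. 142)]
[cite: ImpagliazzoWigderson2001, Thm. 5] -/
theorem _root_.Literature.Computability.Complexity.impagliazzoWigderson1998_samplable_of_LTV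
    {pD : Polynomial ℕ} (hD1 : ∀ n, 1 ≤ pD.eval n)
    (hRSR : ∀ Ev : List Bool → List Bool, Ev ∈ FP → ∃ Ev' corr : List Bool → List Bool, Ev' ∈ FP ∧ corr ∈ FP ∧
      ∃ (pc : Polynomial ℕ) (m₀ : ℕ), ∀ m, m₀ ≤ m → ∀ a : ℕ, 1 ≤ a →
        ∀ d ∈ approxCircuits Ev (hardFn QBFUniv.LTV) (fun m => 2 / ((pD.eval m : ℕ) : ℝ)) m,
          1 - 1 / (a : ℝ) ≤ uniformProb (pc.eval (m + a))
            {u | corr (boolPair d (boolPair (unaryEncodeNat m) (boolPair (unaryEncodeNat a) u))) ∈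
              Bootstrap.circuitsFor Ev' (hardFn QBFUniv.LTV) m}) :
    impagliazzoWigderson1998_samplable :=
  impagliazzoWigderson1998_samplable_of_hardFunction ⟨QBFUniv.LTV, pD, TVHard.isHard_PSPACE_LTV, QBFUniv.LTV_mem_EXP, hD1,
    ⟨TVChk.dsrAlg, 2 * X + 1, TVChk.dsrAlg_isPolyTime, fun x O hO => TVChk.dsrAlg_run x O fun y hy => hO y hy⟩, hRSR⟩

end Assembly

end IWGen2

end Literature.Computability.Complexity

end
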